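import Summits.ResolutionOfSingularities.ResolutionOfSingularities.Theorems.PAlterationPialtFrobenius
import HarnessLib

/-!
# `Pialt` (crux stmt-ResolutionOfSingularities-0555), line `SketchIdeator2` / Card A: stability of RR / LRR

Stubs `stub_rr_of_finite_universallyInjective` and `stub_lrr_of_finite_universallyInjective` of
the lead's skeleton `radicially-regular-endgame` (helper file,
`--supports stmt-ResolutionOfSingularities-0555`; does not close the item).

Call an integral scheme `Z` **radicially regular (RR)** if an integral regular scheme `W` maps
onto it by a finite, universally injective, surjective morphism `W → Z`, and **locally radicially
regular (LRR)** if every point of `Z` has an RR open neighbourhood.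

**Statements.** Over a PERFECT field `k` of characteristic `p`, let `g : Z' → Z` be finite,
universally injective and surjective between integral schemes, with `Z` NORMAL and locally of
finite type over `k`. If `Z` is RR (resp. LRR) then so is `Z'`.

**Proofs.** RR: Frobenius domination (`exists_frobeniusCover_of_finite_universallyInjective`,
Temkin 2013, Rem. 1.3.5(i)) provides an integral `N ≅ Z` (via `φ : N → Z`) with a finite,
universally injective, surjective `ψ : N → Z'`; if `h : W → Z` exhibits `Z` as RR, then
`h ≫ φ⁻¹ ≫ ψ : W → Z'` exhibits `Z'` as RR (the three properties are stable under composition and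
hold for isomorphisms). LRR: for `z' ∈ Z'` pick an RR open neighbourhood `U ∋ g z'`; then
`U' := g⁻¹ U ∋ z'`, the restriction `g ∣_ U : U' → U` is again finite, universally injective
(both Zariski-local at the target) and surjective, `U` is integral, normal (its stalks are those
of `Z`) and locally of finite type over `k`, and `U'` is integral; apply the RR case to `g ∣_ U`.
-/

set_option linter.dupNamespace false -- mandated namespace of this single-conjunct summit

noncomputable section

open CategoryTheory CategoryTheory.Limits AlgebraicGeometry TopologicalSpace
open Literature.AlgebraicGeometry.Resolution

namespace Summit.ResolutionOfSingularities.ResolutionOfSingularities.Theorems.Pialt.RadiciallyRegular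

/-- **Finite radicial covers of normal RR varieties over perfect fields are RR** (stub
`stub_rr_of_finite_universallyInjective` of the line `SketchIdeator2` / Card A). Over a perfect
field `k` of characteristic `p`, let `g : Z' → Z` be finite, universally injective and surjective
between integral schemes, `Z` normal and locally of finite type over `k`. If an integral regular
`W` maps onto `Z` by a finite, universally injective, surjective `h`, then `W` maps so onto `Z'`:
by Frobenius domination (`exists_frobeniusCover_of_finite_universallyInjective`) there is an
integral `N ≅ Z` with a finite, universally injective, surjective `ψ : N → Z'`, and
`h ≫ (N ≅ Z)⁻¹ ≫ ψ` does the job. [cite: Temkin2013, Rem. 1.3.5(i)] -/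
theorem stub_rr_of_finite_universallyInjective (p : ℕ) (hp : p.Prime) (k : Type) [Field k]
    [CharP k p] [PerfectField k] (Z' Z : Scheme.{0}) [IsIntegral Z'] [IsIntegral Z]
    (f : Z ⟶ Spec (.of k)) [LocallyOfFiniteType f] (g : Z' ⟶ Z) [IsFinite g]
    [UniversallyInjective g] (hsurj : Function.Surjective g.base)
    (hN : ∀ z : Z, IsIntegrallyClosed (Z.presheaf.stalk z))
    (hZ : ∃ (W : Scheme.{0}) (h : W ⟶ Z), IsIntegral W ∧ Scheme.IsRegular W ∧ IsFinite h ∧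
      UniversallyInjective h ∧ Function.Surjective h.base) :
    ∃ (W : Scheme.{0}) (h : W ⟶ Z'), IsIntegral W ∧ Scheme.IsRegular W ∧ IsFinite h ∧
      UniversallyInjective h ∧ Function.Surjective h.base := by
  haveI : IsDominant g := ⟨hsurj.denseRange⟩
  -- Frobenius domination: `N ≅ Z` with `ψ : N → Z'` finite, radicial, surjective
  obtain ⟨N, ψ, φ, -, hφ, hψfin, hψui, hψsurj⟩ :=
    exists_frobeniusCover_of_finite_universallyInjective hp k Z' Z f g hN
  obtain ⟨W, h, hW, hWreg, hfin, hui, hhsurj⟩ := hZ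
  haveI := hφ
  haveI := hψfin
  haveI := hψui
  haveI := hfin
  haveI := hui
  haveI : Surjective ψ := ⟨hψsurj⟩
  haveI : Surjective h := ⟨hhsurj⟩
  refine ⟨W, h ≫ inv φ ≫ ψ, hW, hWreg, inferInstance, ?_, Surjective.surj⟩
  exact MorphismProperty.comp_mem _ _ _ hui (MorphismProperty.comp_mem _ _ _ inferInstance hψui)

/-- **Finite radicial covers of normal LRR varieties over perfect fields are LRR** (stub
`stub_lrr_of_finite_universallyInjective` of the line `SketchIdeator2` / Card A). Over a perfect
field `k` of characteristic `p`, let `g : Z' → Z` be finite, universally injective and surjective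
between integral schemes, `Z` normal and locally of finite type over `k`. If every point of `Z`
has an open neighbourhood dominated by an integral regular scheme through a finite, universally
injective, surjective morphism, then so does every point of `Z'`: for `z'` take such a
neighbourhood `U ∋ g z'`; the restriction `g ∣_ U : g⁻¹ U → U` is finite, universally injective
and surjective between integral schemes, `U` is normal and locally of finite type over `k`, so
the RR case `stub_rr_of_finite_universallyInjective` applies to it. [cite: Temkin2013, Rem. 1.3.5(i)] -/
theorem stub_lrr_of_finite_universallyInjective (p : ℕ) (hp : p.Prime) (k : Type) [Field k]
    [CharP k p] [PerfectField k] (Z' Z : Scheme.{0}) [IsIntegral Z'] [IsIntegral Z]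
    (f : Z ⟶ Spec (.of k)) [LocallyOfFiniteType f] (g : Z' ⟶ Z) [IsFinite g]
    [UniversallyInjective g] (hsurj : Function.Surjective g.base)
    (hN : ∀ z : Z, IsIntegrallyClosed (Z.presheaf.stalk z))
    (hZ : ∀ z : Z, ∃ U : Z.Opens, z ∈ U ∧ ∃ (W : Scheme.{0}) (h : W ⟶ (U : Scheme.{0})),
      IsIntegral W ∧ Scheme.IsRegular W ∧ IsFinite h ∧ UniversallyInjective h ∧
        Function.Surjective h.base) :
    ∀ z' : Z', ∃ U' : Z'.Opens, z' ∈ U' ∧ ∃ (W : Scheme.{0}) (h : W ⟶ (U' : Scheme.{0})),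
      IsIntegral W ∧ Scheme.IsRegular W ∧ IsFinite h ∧ UniversallyInjective h ∧
        Function.Surjective h.base := by
  intro z'
  -- an RR open neighbourhood `U` of `g z'` and its preimage `U' := g⁻¹ U ∋ z'`
  obtain ⟨U, hzU, hU⟩ := hZ (g.base z')
  have hz'U : z' ∈ g ⁻¹ᵁ U := hzU
  -- `U` and `U'` are integral (nonempty opens of integral schemes)
  haveI : Nonempty U := ⟨⟨g.base z', hzU⟩⟩
  haveI : Nonempty (g ⁻¹ᵁ U : Z'.Opens) := ⟨⟨z', hz'U⟩⟩
  -- `g ∣_ U` is finite (instance), universally injective and surjective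
  haveI : UniversallyInjective (g ∣_ U) := IsZariskiLocalAtTarget.restrict ‹_› U
  have hsurj' : Surjective (g ∣_ U) :=
    IsZariskiLocalAtTarget.restrict (P := @Surjective) ⟨hsurj⟩ U
  -- `U` is normal: its stalks are those of `Z`
  have hN' : ∀ u : (U : Scheme.{0}), IsIntegrallyClosed ((U : Scheme.{0}).presheaf.stalk u) :=
    fun u =>
      haveI := hN (U.ι.base u)
      IsIntegrallyClosed.of_equiv (asIso (U.ι.stalkMap u)).commRingCatIsoToRingEquiv
  -- the RR case for `g ∣_ U : U' → U` over `k` (via `U.ι ≫ f`)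
  obtain ⟨W, h, hW, hWreg, hfin, hui, hhsurj⟩ :=
    stub_rr_of_finite_universallyInjective p hp k (g ⁻¹ᵁ U) U (U.ι ≫ f) (g ∣_ U) hsurj'.surj
      hN' hU
  exact ⟨g ⁻¹ᵁ U, hz'U, W, h, hW, hWreg, hfin, hui, hhsurj⟩

end Summit.ResolutionOfSingularities.ResolutionOfSingularities.Theorems.Pialt.RadiciallyRegular

end
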